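import Summits.QuantumFields.BalabanUV.Beta.PolarizationFubini
import Literature.MathematicalPhysics.QuantumFieldTheory.Balaban1983to89.Beta.SliceComposition

/-!
# `BalabanUV.Beta.LogZFubiniCompSlice` — binder row D1, route (O3), work item W-1: **THE ONE-LOOP FUNCTIONALS OF THE COMPOSED-SLICE SYSTEM
# ADD UP AS FUNCTIONS OF THE BACKGROUND** — an5's `SliceComposition.det_kkt_comp_slice` POINTWISE in the background, packaged as `OneLoop.Family`s and
# fed to K-U2c's `logZ_fubini_of_det_factorisation`
# (β sub-cell, BINDER-OWNERS row D1 OWNER, lineage an2 gen 23; sequel of K-U2c p237750; `ROUTE-O3.md` §3 W-1)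

HONEST FRAMING (cell charter, verbatim): «discharging BetaPertH makes Balaban's UV stability UNCONDITIONAL — a real
constructive-QFT result; it is NOT the continuum limit and NOT the Clay problem.»
HONEST DEPENDENCY: continuum YM on T⁴ ⇐ BetaPertH ∧ nine spine estimates (0/9 proved); BetaPertH ⇐ (D1) ∧ (D4) ∧ CAP+tail;
G-an2-4 gates asym, D1 and NE2/3/4.
ABSOLUTE RULE (cell, verbatim): «No internally-minted statement may enter as a cited fact. Every hypothesis is either kernel-proved in this
package or a verbatim quotation of a PUBLISHED theorem with page reference. The manuscript(s) under audit are NOT citable for their own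
disputed steps — they are the thing under adjudication; programme-internal (2001/route/tribunal) claims are never citable.»
NOTHING below is cited: no `[cite: …]`, no `def`, no `Prop` fact.  Every declaration is [folklore] finite-dimensional linear algebra ∕ real logarithms over
an5's `SliceComposition.det_kkt_comp_slice` ∕ `det_kkt_reindex`, pv09∕an2's `OneLoop.ConstrainedGaussian` ∕ `Family.logZ`, and K-U2c's
`PolarizationFubini.logZ_fubini_of_det_factorisation` BY NAME.  It asserts nothing about Bałaban's objects: the matrix-valued background FUNCTIONS
`K, Q₁, Q₂, W₁` and the fixed slices `τ₁, τ₂` are PARAMETERS, an5's composed-slice hypotheses are taken EVENTUALLY in the background.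

WHY (row-D1 owner, gen 23; `HOME/b2b-balaban-beta-an2/gen23/ROUTE-O3.md` §1 (2), §3 W-1).  Route (O3) reads the telescoping clause (T′) of row D1 as
«one-loop functionals add along the step minimiser (Fubini) ⟹ second jets telescope up to a tadpole (K-U2∕K-U2b)».  K-U2c turned the Fubini hypothesis
into «the bordered determinants factor pointwise in the background».  an5's `SliceComposition` §7 IS that factorisation at fixed matrices for the COMPOSED
SLICE `τ̃ = [τ₂Q₁; τ₁]`: `det kkt(K,[Q₂Q₁;τ̃]) = (−1)^{|μ|}·det kkt(K,[Q₁;τ₁])·det kkt(𝒮₁₁,[Q₂;τ₂])`, `𝒮₁₁ = (effForm K [Q₁;τ₁]).toBlocks₁₁` the physical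
corner of the effective form.  THIS FILE applies it at every background near `0` to matrix-valued functions `K(B), Q₁(B), Q₂(B), W₁(B)`, packages the
three sliced systems (composite, fine, step) as `ConstrainedGaussian`-valued families (constraint rows Fin-reindexed, determinant unchanged by
`det_kkt_reindex`), and concludes `F_comp.logZ = F_fine.logZ + F_step.logZ + c` near `0` with the explicit constant.  What it leaves to W-2 is the
factoring of `F_fine` through the step minimiser as a map on backgrounds; what it leaves to the torus∕ℤ⁴ roads is everything infinite-dimensional.

WHAT (all [folklore]; sizes `n` fine field, `n₁` block field, `n₂` coarse block field, `r₁`, `r₂` slice rows; backgrounds `B : ι → ℝ`):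
§1 `kkt_eq` (`ConstrainedGaussian.kkt ⟨Q, Δ⟩ = Composition.kkt Δ Q`, rfl), `det_kkt_mk_submatrix` (Fin-reindexing the constraint rows leaves the bordered
   determinant unchanged).
§2 **`det_factorisation_comp_slice`**: pointwise in `B`, under an5's hypotheses AT `B` (`K W₁ = 0`, `Kᵀ W₁ = 0`, `Q₁ W₁ = 0`, `IsUnit (τ₁W₁).det`,
   `IsUnit (kkt K [Q₁;τ₁]).det`): `det kkt_comp(B) = (−1)^{n₁} · det kkt_fine(B) · det kkt_step(B)` for the three packaged systems.
§3 **`logZ_fubini_comp_slice`**: the hypotheses EVENTUALLY near `0` + `IsUnit (kkt 𝒮₁₁(B) [Q₂(B);τ₂]).det` eventually ⟹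
   `F_comp.logZ =ᶠ[𝓝 0] F_fine.logZ + F_step.logZ + c`, `c = ((n − (n₂+(r₂+r₁))) − (n − (n₁+r₁)) − (n₁ − (n₂+r₂)))/2 · log 2π − ½·log|(−1)^{n₁}|` (the last
   logarithm is `0`; kept in K-U2c's general shape, simplified in `logZ_fubini_comp_slice'`).
Provenance: β sub-cell, unit beta-an2 gen 23 (prover-b2b-balaban-beta-an2-g23-0), 2026-08-20.  NOT (SDF), NOT D1, NOT `BetaPertH`, NOT continuum, NOT Clay.
-/

open Filter Topology Matrix
open scoped Matrix
open Literature.MathematicalPhysics.QuantumFieldTheory.Balaban1983to89.Beta (Family ConstrainedGaussian)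
open Literature.MathematicalPhysics.QuantumFieldTheory.Balaban1983to89.Beta.Composition (kkt)
open Literature.MathematicalPhysics.QuantumFieldTheory.Balaban1983to89.Beta.CompositionSingular (effForm)
open Literature.MathematicalPhysics.QuantumFieldTheory.Balaban1983to89.Beta.SliceComposition (det_kkt_comp_slice det_kkt_reindex)
open Summit.QuantumFields.BalabanUV.Beta.PolarizationFubini (logZ_fubini_of_det_factorisation)

namespace Summit.QuantumFields.BalabanUV.Beta.LogZFubiniCompSlice

/-! ## §1 The bordered matrix of a `ConstrainedGaussian` and Fin-reindexing of constraint rows -/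

/-- [folklore] The bordered matrix of the typed constrained Gaussian datum IS `Composition.kkt Δ Q`. -/
theorem kkt_eq {n m : ℕ} (Q : Matrix (Fin m) (Fin n) ℝ) (Δ : Matrix (Fin n) (Fin n) ℝ) :
    (ConstrainedGaussian.mk Q Δ).kkt = kkt Δ Q := rfl

/-- [folklore] Fin-reindexing the constraint rows of a sliced system leaves the bordered determinant unchanged. -/
theorem det_kkt_mk_submatrix {n m : ℕ} {μ : Type*} [Fintype μ] [DecidableEq μ] (Q : Matrix μ (Fin n) ℝ) (Δ : Matrix (Fin n) (Fin n) ℝ)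
    (e : Fin m ≃ μ) : (ConstrainedGaussian.mk (Q.submatrix e id) Δ).kkt.det = (kkt Δ Q).det := by
  rw [kkt_eq, det_kkt_reindex]

/-! ## §2 The determinant factorisation of the composed-slice system, pointwise in the background -/

section Pointwise

variable {ι : Type*} {n n₁ n₂ r₁ r₂ : ℕ}

/-- [folklore] **DETERMINANT FACTORISATION OF THE COMPOSED-SLICE SYSTEM, POINTWISE IN THE BACKGROUND** (an5's `det_kkt_comp_slice` at the matrices
`K B, Q₁ B, Q₂ B, W₁ B`, fixed slices `τ₁, τ₂`): with the three packaged systems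
`F_comp B := ⟨[Q₂Q₁; [τ₂Q₁; τ₁]](B) (reindexed), K B⟩`, `F_fine B := ⟨[Q₁;τ₁](B) (reindexed), K B⟩`, `F_step B := ⟨[Q₂;τ₂](B) (reindexed), 𝒮₁₁(B)⟩`,
`det kkt F_comp(B) = (−1)^{n₁} · det kkt F_fine(B) · det kkt F_step(B)`. -/
theorem det_factorisation_comp_slice (K : (ι → ℝ) → Matrix (Fin n) (Fin n) ℝ) (Q₁ : (ι → ℝ) → Matrix (Fin n₁) (Fin n) ℝ)
    (Q₂ : (ι → ℝ) → Matrix (Fin n₂) (Fin n₁) ℝ) (W₁ : (ι → ℝ) → Matrix (Fin n) (Fin r₁) ℝ) (τ₁ : Matrix (Fin r₁) (Fin n) ℝ)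
    (τ₂ : Matrix (Fin r₂) (Fin n₁) ℝ) (e₂ : Fin (n₂ + (r₂ + r₁)) ≃ Fin n₂ ⊕ (Fin r₂ ⊕ Fin r₁)) (e₁ : Fin (n₁ + r₁) ≃ Fin n₁ ⊕ Fin r₁)
    (es : Fin (n₂ + r₂) ≃ Fin n₂ ⊕ Fin r₂) (B : ι → ℝ)
    (hKW : K B * W₁ B = 0) (hKtW : (K B)ᵀ * W₁ B = 0) (hQW : Q₁ B * W₁ B = 0) (hT : IsUnit (τ₁ * W₁ B).det)
    (h1 : IsUnit (kkt (K B) (fromRows (Q₁ B) τ₁)).det) :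
    (ConstrainedGaussian.mk ((fromRows (Q₂ B * Q₁ B) (fromRows (τ₂ * Q₁ B) τ₁)).submatrix e₂ id) (K B)).kkt.det =
      (-1 : ℝ) ^ n₁ * (ConstrainedGaussian.mk ((fromRows (Q₁ B) τ₁).submatrix e₁ id) (K B)).kkt.det *
        (ConstrainedGaussian.mk ((fromRows (Q₂ B) τ₂).submatrix es id) (effForm (K B) (fromRows (Q₁ B) τ₁)).toBlocks₁₁).kkt.det := by
  rw [det_kkt_mk_submatrix, det_kkt_mk_submatrix, det_kkt_mk_submatrix,
    det_kkt_comp_slice (K B) (Q₁ B) τ₁ (W₁ B) (Q₂ B) τ₂ hKW hKtW hQW hT h1, Fintype.card_fin, mul_assoc]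

end Pointwise

/-! ## §3 The one-loop functionals add near the trivial background -/

section Fubini

variable {ι : Type*} {n n₁ n₂ r₁ r₂ : ℕ}

/-- [folklore] **`logZ` FUBINI FOR THE COMPOSED-SLICE SYSTEM** (route (O3) work item W-1): if an5's composed-slice hypotheses hold at every background
near `0` and the step system is nonsingular there, then
`F_comp.logZ =ᶠ[𝓝 0] F_fine.logZ + F_step.logZ + c` with `c = ((n − (n₂+(r₂+r₁))) − (n − (n₁+r₁)) − (n₁ − (n₂+r₂)))/2 · log 2π − ½·log|(−1)^{n₁}|`. -/
theorem logZ_fubini_comp_slice (K : (ι → ℝ) → Matrix (Fin n) (Fin n) ℝ) (Q₁ : (ι → ℝ) → Matrix (Fin n₁) (Fin n) ℝ)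
    (Q₂ : (ι → ℝ) → Matrix (Fin n₂) (Fin n₁) ℝ) (W₁ : (ι → ℝ) → Matrix (Fin n) (Fin r₁) ℝ) (τ₁ : Matrix (Fin r₁) (Fin n) ℝ)
    (τ₂ : Matrix (Fin r₂) (Fin n₁) ℝ) (e₂ : Fin (n₂ + (r₂ + r₁)) ≃ Fin n₂ ⊕ (Fin r₂ ⊕ Fin r₁)) (e₁ : Fin (n₁ + r₁) ≃ Fin n₁ ⊕ Fin r₁)
    (es : Fin (n₂ + r₂) ≃ Fin n₂ ⊕ Fin r₂)
    (hKW : ∀ᶠ B in 𝓝 (0 : ι → ℝ), K B * W₁ B = 0) (hKtW : ∀ᶠ B in 𝓝 (0 : ι → ℝ), (K B)ᵀ * W₁ B = 0)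
    (hQW : ∀ᶠ B in 𝓝 (0 : ι → ℝ), Q₁ B * W₁ B = 0) (hT : ∀ᶠ B in 𝓝 (0 : ι → ℝ), IsUnit (τ₁ * W₁ B).det)
    (h1 : ∀ᶠ B in 𝓝 (0 : ι → ℝ), IsUnit (kkt (K B) (fromRows (Q₁ B) τ₁)).det)
    (h2 : ∀ᶠ B in 𝓝 (0 : ι → ℝ), IsUnit (kkt (effForm (K B) (fromRows (Q₁ B) τ₁)).toBlocks₁₁ (fromRows (Q₂ B) τ₂)).det) :
    Family.logZ (fun B => ConstrainedGaussian.mk ((fromRows (Q₂ B * Q₁ B) (fromRows (τ₂ * Q₁ B) τ₁)).submatrix e₂ id) (K B) :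
        Family ι n (n₂ + (r₂ + r₁)))
      =ᶠ[𝓝 0] fun B =>
        Family.logZ (fun B => ConstrainedGaussian.mk ((fromRows (Q₁ B) τ₁).submatrix e₁ id) (K B) : Family ι n (n₁ + r₁)) B
        + Family.logZ (fun B => ConstrainedGaussian.mk ((fromRows (Q₂ B) τ₂).submatrix es id) (effForm (K B) (fromRows (Q₁ B) τ₁)).toBlocks₁₁ :
            Family ι n₁ (n₂ + r₂)) B
        + ((((n : ℝ) - (n₂ + (r₂ + r₁) : ℕ)) - ((n : ℝ) - (n₁ + r₁ : ℕ)) - ((n₁ : ℝ) - (n₂ + r₂ : ℕ))) / 2 * Real.log (2 * Real.pi)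
            - (1 / 2 : ℝ) * Real.log |(-1 : ℝ) ^ n₁|) := by
  refine logZ_fubini_of_det_factorisation _ _ _ (pow_ne_zero _ (by norm_num)) ?_ ?_ ?_
  · filter_upwards [hKW, hKtW, hQW, hT, h1] with B hKW hKtW hQW hT h1
    exact det_factorisation_comp_slice K Q₁ Q₂ W₁ τ₁ τ₂ e₂ e₁ es B hKW hKtW hQW hT h1
  · filter_upwards [h1] with B h1
    rw [det_kkt_mk_submatrix]
    exact h1.ne_zero
  · filter_upwards [h2] with B h2
    rw [det_kkt_mk_submatrix]
    exact h2.ne_zero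

/-- [folklore] `log|(−1)^{n₁}| = 0`: the sign of the pinned block variable contributes nothing to the one-loop functional. -/
theorem log_abs_neg_one_pow (k : ℕ) : Real.log |(-1 : ℝ) ^ k| = 0 := by
  rw [abs_pow, abs_neg, abs_one, one_pow, Real.log_one]

/-- [folklore] **THE SAME WITH THE CONSTANT SIMPLIFIED**: `c = ((n₁ + r₁ : ℕ) − (n₂ + (r₂ + r₁) : ℕ) − (n₁ − (n₂ + r₂ : ℕ)))/2 · log 2π` written as K-U2c
delivers it, with `log|(−1)^{n₁}| = 0` removed. -/
theorem logZ_fubini_comp_slice' (K : (ι → ℝ) → Matrix (Fin n) (Fin n) ℝ) (Q₁ : (ι → ℝ) → Matrix (Fin n₁) (Fin n) ℝ)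
    (Q₂ : (ι → ℝ) → Matrix (Fin n₂) (Fin n₁) ℝ) (W₁ : (ι → ℝ) → Matrix (Fin n) (Fin r₁) ℝ) (τ₁ : Matrix (Fin r₁) (Fin n) ℝ)
    (τ₂ : Matrix (Fin r₂) (Fin n₁) ℝ) (e₂ : Fin (n₂ + (r₂ + r₁)) ≃ Fin n₂ ⊕ (Fin r₂ ⊕ Fin r₁)) (e₁ : Fin (n₁ + r₁) ≃ Fin n₁ ⊕ Fin r₁)
    (es : Fin (n₂ + r₂) ≃ Fin n₂ ⊕ Fin r₂)
    (hKW : ∀ᶠ B in 𝓝 (0 : ι → ℝ), K B * W₁ B = 0) (hKtW : ∀ᶠ B in 𝓝 (0 : ι → ℝ), (K B)ᵀ * W₁ B = 0)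
    (hQW : ∀ᶠ B in 𝓝 (0 : ι → ℝ), Q₁ B * W₁ B = 0) (hT : ∀ᶠ B in 𝓝 (0 : ι → ℝ), IsUnit (τ₁ * W₁ B).det)
    (h1 : ∀ᶠ B in 𝓝 (0 : ι → ℝ), IsUnit (kkt (K B) (fromRows (Q₁ B) τ₁)).det)
    (h2 : ∀ᶠ B in 𝓝 (0 : ι → ℝ), IsUnit (kkt (effForm (K B) (fromRows (Q₁ B) τ₁)).toBlocks₁₁ (fromRows (Q₂ B) τ₂)).det) :
    Family.logZ (fun B => ConstrainedGaussian.mk ((fromRows (Q₂ B * Q₁ B) (fromRows (τ₂ * Q₁ B) τ₁)).submatrix e₂ id) (K B) :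
        Family ι n (n₂ + (r₂ + r₁)))
      =ᶠ[𝓝 0] fun B =>
        Family.logZ (fun B => ConstrainedGaussian.mk ((fromRows (Q₁ B) τ₁).submatrix e₁ id) (K B) : Family ι n (n₁ + r₁)) B
        + Family.logZ (fun B => ConstrainedGaussian.mk ((fromRows (Q₂ B) τ₂).submatrix es id) (effForm (K B) (fromRows (Q₁ B) τ₁)).toBlocks₁₁ :
            Family ι n₁ (n₂ + r₂)) B
        + (((n : ℝ) - (n₂ + (r₂ + r₁) : ℕ)) - ((n : ℝ) - (n₁ + r₁ : ℕ)) - ((n₁ : ℝ) - (n₂ + r₂ : ℕ))) / 2 * Real.log (2 * Real.pi) := by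
  have h := logZ_fubini_comp_slice K Q₁ Q₂ W₁ τ₁ τ₂ e₂ e₁ es hKW hKtW hQW hT h1 h2
  simp only [log_abs_neg_one_pow, mul_zero, sub_zero] at h
  exact h

end Fubini

end Summit.QuantumFields.BalabanUV.Beta.LogZFubiniCompSlice
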